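import Mathlib

/-!
# EVERY ROW `(q,u)` OF (Π) ON `U_{s,k} ⊕ U_{m,m}` — THE ARITHMETIC CORE, PART 1: WEIGHTS AND THE TWO SUMS (night-3 g25)

`proofs/NIGHT3-G25-GRADED.md` §3–§4.  For the direct sum `N = U_{s,k} ⊕ U_{m,m}` (a rank-`s` uniform flat on `k` points plus
`m` free points) the row `(q,u)` of (Π), in its price-identity form `Σ_{ρ(B)=q, ρ(E∖B)≥u} C(ρ(E∖B), u−q) ≤ C(u,q)·#{S : ρ(S)=u}`,
reads, members and level sets counted by their number of fat points,
  `Σ_i C(k,i)·[c_i ≤ q ∧ u ≤ p_i]·C(m, q−c_i)·C(p_i, u−q)  ≤  C(u,q)·Σ_j C(k,j)·[c_j ≤ u]·C(m, u−c_j)`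
with `c_i = min(i,s)` and `p_i = min(k−i,s) + (m − (q − c_i))` the complement rank.  This module: the weight lemma
`choose_mul_choose_le_add` (`C(m,a)C(a,b) ≤ C(m,a+L)C(a+L,b+L)` for `b ≤ a`, `a+b+L ≤ m`, by factorials), the two Vandermonde
evaluations, and the rewriting of both sides as weighted sums over pairs of subsets of the flat — sources `(I, D ⊆ J₀(F∖I))`
(`sum_sources_eq`) and slots `(J, Q ⊆ J₀ J)` (`sum_slots_eq`), `J₀` any basis selector (`J₀ J ⊆ J`, `#J₀ J = min(#J,s)`).
The injection between them is in `C025ProfileOneFlatRowsInj`.  No `def`, no `instance`, no notation.  Axioms: standard.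
-/

namespace PercRepro

namespace OneFlat

open Finset

/-- `a! · (b+L)! ≤ (a+L)! · b!` for `b ≤ a` (the `l`-th factor `b+l ≤ a+l`). -/
theorem factorial_mul_factorial_le (L : ℕ) : ∀ {a b : ℕ}, b ≤ a →
    a.factorial * (b + L).factorial ≤ (a + L).factorial * b.factorial := by
  induction L with
  | zero => intro a b _; simp
  | succ L ih =>
    intro a b hba
    have h1 : (b + (L + 1)).factorial = (b + L + 1) * (b + L).factorial := by
      rw [show b + (L + 1) = b + L + 1 by omega, Nat.factorial_succ]
    have h2 : (a + (L + 1)).factorial = (a + L + 1) * (a + L).factorial := by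
      rw [show a + (L + 1) = a + L + 1 by omega, Nat.factorial_succ]
    rw [h1, h2]
    calc a.factorial * ((b + L + 1) * (b + L).factorial)
        = (b + L + 1) * (a.factorial * (b + L).factorial) := by ring
      _ ≤ (a + L + 1) * ((a + L).factorial * b.factorial) :=
          Nat.mul_le_mul (by omega) (ih hba)
      _ = (a + L + 1) * (a + L).factorial * b.factorial := by ring

/-- `G(a,b) := C(m,a)·C(a,b)` satisfies `G(a,b)·(m−a)!·b!·(a−b)! = m!` for `b ≤ a ≤ m`. -/
theorem choose_mul_choose_mul_factorials {m a b : ℕ} (hba : b ≤ a) (ham : a ≤ m) :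
    m.choose a * a.choose b * ((m - a).factorial * b.factorial * (a - b).factorial) = m.factorial := by
  have h1 := Nat.choose_mul_factorial_mul_factorial ham
  have h2 := Nat.choose_mul_factorial_mul_factorial hba
  calc m.choose a * a.choose b * ((m - a).factorial * b.factorial * (a - b).factorial)
      = m.choose a * (a.choose b * b.factorial * (a - b).factorial) * (m - a).factorial := by ring
    _ = m.choose a * a.factorial * (m - a).factorial := by rw [h2]
    _ = m.factorial := h1

/-- **THE WEIGHT LEMMA**: `G(a,b) ≤ G(a+L, b+L)` whenever `b ≤ a` and `a + b + L ≤ m`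
(`G(a+L,b+L)/G(a,b) = Π_{l=1}^{L} (m−a−L+l)/(b+l) ≥ 1`). -/
theorem choose_mul_choose_le_add {m a b L : ℕ} (hba : b ≤ a) (habL : a + b + L ≤ m) :
    m.choose a * a.choose b ≤ m.choose (a + L) * (a + L).choose (b + L) := by
  have ham : a ≤ m := by omega
  have haLm : a + L ≤ m := by omega
  have e1 := choose_mul_choose_mul_factorials (m := m) hba ham
  have e2 := choose_mul_choose_mul_factorials (m := m) (a := a + L) (b := b + L) (by omega) haLm
  have hd : a + L - (b + L) = a - b := by omega
  rw [hd] at e2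
  have hf := factorial_mul_factorial_le L (a := m - a - L) (b := b) (by omega)
  have hmaL : m - a - L + L = m - a := by omega
  rw [hmaL] at hf
  have hmal : m - (a + L) = m - a - L := by omega
  rw [hmal] at e2
  have hpos : 0 < (m - a - L).factorial * (b + L).factorial * (a - b).factorial := by positivity
  have key : m.choose a * a.choose b * ((m - a - L).factorial * (b + L).factorial * (a - b).factorial) ≤
      m.choose (a + L) * (a + L).choose (b + L) *
        ((m - a - L).factorial * (b + L).factorial * (a - b).factorial) := by
    calc m.choose a * a.choose b * ((m - a - L).factorial * (b + L).factorial * (a - b).factorial)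
        ≤ m.choose a * a.choose b * ((m - a).factorial * b.factorial * (a - b).factorial) := by
          apply Nat.mul_le_mul_left
          apply Nat.mul_le_mul_right
          exact hf
      _ = m.factorial := e1
      _ = m.choose (a + L) * (a + L).choose (b + L) *
            ((m - a - L).factorial * (b + L).factorial * (a - b).factorial) := e2.symm
  exact Nat.le_of_mul_le_mul_right key hpos

variable {α : Type} [DecidableEq α]

/-- Reindexing a truncated sum: `Σ_{a < K+1} [a ≤ d] f a = Σ_{a < d+1} f a` when `f a = 0` for `a > K`. -/
theorem sum_range_ite_le_eq {M : Type*} [AddCommMonoid M] (K d : ℕ) (f : ℕ → M) (hf : ∀ a, K < a → f a = 0) :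
    (∑ a ∈ range (K + 1), if a ≤ d then f a else 0) = ∑ a ∈ range (d + 1), f a := by
  rw [← sum_filter]
  apply sum_subset
  · intro a ha
    rw [mem_filter, mem_range] at ha
    rw [mem_range]; omega
  · intro a ha hna
    rw [mem_range] at ha
    rw [mem_filter, mem_range, not_and_or] at hna
    rcases hna with h | h
    · exact hf a (by omega)
    · omega

/-- Vandermonde along a basis: `Σ_a C(K,a)·[a ≤ u−q]·C(m, u−c−a)·C(u−c−a, q−c) = C(m, q−c)·C(K + (m − (q−c)), u−q)` for `c ≤ q ≤ u`. -/
theorem sum_choose_mul_choose_mul_choose (K m c q u : ℕ) (hcq : c ≤ q) (hqu : q ≤ u) :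
    (∑ a ∈ range (K + 1), K.choose a *
        (if a ≤ u - q then m.choose (u - c - a) * (u - c - a).choose (q - c) else 0)) =
      m.choose (q - c) * (K + (m - (q - c))).choose (u - q) := by
  by_cases hqm : q - c ≤ m
  · -- union first: `C(m, u−c−a)·C(u−c−a, q−c) = C(m, q−c)·C(m−(q−c), u−q−a)` for `a ≤ u − q`
    have hterm : ∀ a, a ≤ u - q →
        m.choose (u - c - a) * (u - c - a).choose (q - c) = m.choose (q - c) * (m - (q - c)).choose (u - q - a) := by
      intro a ha
      rw [Nat.choose_mul (by omega)]
      congr 2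
      omega
    have h1 : (∑ a ∈ range (K + 1), K.choose a *
          (if a ≤ u - q then m.choose (u - c - a) * (u - c - a).choose (q - c) else 0)) =
        m.choose (q - c) * ∑ a ∈ range (K + 1),
          (if a ≤ u - q then K.choose a * (m - (q - c)).choose (u - q - a) else 0) := by
      rw [mul_sum]
      apply sum_congr rfl
      intro a _
      split_ifs with ha
      · rw [hterm a ha]; ring
      · simp
    rw [h1, sum_range_ite_le_eq K (u - q) (fun a => K.choose a * (m - (q - c)).choose (u - q - a))
      (fun a ha => by rw [Nat.choose_eq_zero_of_lt ha, zero_mul])]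
    rw [Nat.add_choose_eq, Finset.Nat.sum_antidiagonal_eq_sum_range_succ
      (fun i j => K.choose i * (m - (q - c)).choose j)]
  · -- no member: every `C(m, u−c−a)` with `u − c − a ≥ q − c > m` vanishes
    have h0 : m.choose (q - c) = 0 := Nat.choose_eq_zero_of_lt (by omega)
    rw [h0, zero_mul]
    apply sum_eq_zero
    intro a _
    split_ifs with ha
    · have h0 : m.choose (u - c - a) = 0 := Nat.choose_eq_zero_of_lt (by omega)
      rw [h0, zero_mul, mul_zero]
    · exact mul_zero _

/-- Vandermonde on a level set: `Σ_x C(c,x)·[x ≤ q]·C(u−c, q−x) = C(u,q)` for `c ≤ u`. -/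
theorem sum_choose_mul_choose_eq_choose (c q u : ℕ) (hcu : c ≤ u) :
    (∑ x ∈ range (c + 1), c.choose x * (if x ≤ q then (u - c).choose (q - x) else 0)) = u.choose q := by
  have h1 : (∑ x ∈ range (c + 1), c.choose x * (if x ≤ q then (u - c).choose (q - x) else 0)) =
      ∑ x ∈ range (c + 1), (if x ≤ q then c.choose x * (u - c).choose (q - x) else 0) := by
    apply sum_congr rfl
    intro x _
    split_ifs <;> simp
  rw [h1, sum_range_ite_le_eq c q (fun x => c.choose x * (u - c).choose (q - x))
    (fun x hx => by rw [Nat.choose_eq_zero_of_lt hx, zero_mul])]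
  rw [← Finset.Nat.sum_antidiagonal_eq_sum_range_succ (fun i j => c.choose i * (u - c).choose j),
    ← Nat.add_choose_eq, Nat.add_sub_cancel' hcu]


/-- (3a): the sum over the sources equals the type-count left side. -/
theorem sum_sources_eq (F : Finset α) (s m q u : ℕ) (hqu : q ≤ u)
    (J₀ : Finset α → Finset α) (hJ₀ : ∀ J, J₀ J ⊆ J ∧ (J₀ J).card = min J.card s) :
    ∑ σ ∈ (F.powerset ×ˢ F.powerset).filter (fun σ : Finset α × Finset α =>
        σ.2 ⊆ J₀ (F \ σ.1) ∧ min σ.1.card s ≤ q ∧ σ.2.card ≤ u - q ∧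
          u ≤ min (F \ σ.1).card s + (m - (q - min σ.1.card s))),
        m.choose (u - min σ.1.card s - σ.2.card) * (u - min σ.1.card s - σ.2.card).choose (q - min σ.1.card s) =
      ∑ i ∈ range (F.card + 1), F.card.choose i *
        (if min i s ≤ q ∧ u ≤ min (F.card - i) s + (m - (q - min i s)) then
          m.choose (q - min i s) * (min (F.card - i) s + (m - (q - min i s))).choose (u - q) else 0) := by
  rw [sum_filter, sum_product]
  -- the inner sum depends on `I` only through `#I`
  have hinner : ∀ I ∈ F.powerset,
      (∑ D ∈ F.powerset, if D ⊆ J₀ (F \ I) ∧ min I.card s ≤ q ∧ D.card ≤ u - q ∧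
          u ≤ min (F \ I).card s + (m - (q - min I.card s)) then
          m.choose (u - min I.card s - D.card) * (u - min I.card s - D.card).choose (q - min I.card s) else 0) =
        (if min I.card s ≤ q ∧ u ≤ min (F.card - I.card) s + (m - (q - min I.card s)) then
          m.choose (q - min I.card s) * (min (F.card - I.card) s + (m - (q - min I.card s))).choose (u - q) else 0) := by
    intro I hI
    rw [mem_powerset] at hI
    have hK := hJ₀ (F \ I)
    have hFI : (F \ I).card = F.card - I.card := card_sdiff_of_subset hI
    have hKc : (J₀ (F \ I)).card = min (F.card - I.card) s := by rw [hK.2, hFI]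
    have hKF : J₀ (F \ I) ⊆ F := hK.1.trans sdiff_subset
    rw [hFI]
    -- restrict to `D ⊆ J₀(F ∖ I)`
    have h1 : (∑ D ∈ F.powerset, if D ⊆ J₀ (F \ I) ∧ min I.card s ≤ q ∧ D.card ≤ u - q ∧
          u ≤ min (F.card - I.card) s + (m - (q - min I.card s)) then
          m.choose (u - min I.card s - D.card) * (u - min I.card s - D.card).choose (q - min I.card s) else 0) =
        ∑ D ∈ (J₀ (F \ I)).powerset, if min I.card s ≤ q ∧ D.card ≤ u - q ∧
          u ≤ min (F.card - I.card) s + (m - (q - min I.card s)) then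
          m.choose (u - min I.card s - D.card) * (u - min I.card s - D.card).choose (q - min I.card s) else 0 := by
      rw [← sum_subset (powerset_mono.2 hKF)]
      · apply sum_congr rfl
        intro D hD
        rw [mem_powerset] at hD
        simp only [hD, true_and]
      · intro D _ hDn
        rw [mem_powerset] at hDn
        simp only [hDn, false_and, if_false]
    rw [h1]
    by_cases hc : min I.card s ≤ q ∧ u ≤ min (F.card - I.card) s + (m - (q - min I.card s))
    · rw [if_pos hc]
      have h2 : (∑ D ∈ (J₀ (F \ I)).powerset, if min I.card s ≤ q ∧ D.card ≤ u - q ∧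
            u ≤ min (F.card - I.card) s + (m - (q - min I.card s)) then
            m.choose (u - min I.card s - D.card) * (u - min I.card s - D.card).choose (q - min I.card s) else 0) =
          ∑ D ∈ (J₀ (F \ I)).powerset, (fun a => if a ≤ u - q then
            m.choose (u - min I.card s - a) * (u - min I.card s - a).choose (q - min I.card s) else 0) D.card := by
        apply sum_congr rfl
        intro D _
        simp only [hc.1, hc.2, true_and, and_true]
      rw [h2, sum_powerset_apply_card (fun a => if a ≤ u - q then
            m.choose (u - min I.card s - a) * (u - min I.card s - a).choose (q - min I.card s) else 0), hKc]
      simp only [smul_eq_mul]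
      exact sum_choose_mul_choose_mul_choose _ m _ q u hc.1 hqu
    · rw [if_neg hc]
      apply sum_eq_zero
      intro D _
      rw [if_neg]
      intro h
      exact hc ⟨h.1, h.2.2⟩
  rw [sum_congr rfl hinner]
  rw [sum_powerset_apply_card (fun i => if min i s ≤ q ∧ u ≤ min (F.card - i) s + (m - (q - min i s)) then
          m.choose (q - min i s) * (min (F.card - i) s + (m - (q - min i s))).choose (u - q) else 0)]
  simp only [smul_eq_mul]

/-- (3b): the sum over the slots equals `C(u,q)` times the type-count right side. -/
theorem sum_slots_eq (F : Finset α) (s m q u : ℕ)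
    (J₀ : Finset α → Finset α) (hJ₀ : ∀ J, J₀ J ⊆ J ∧ (J₀ J).card = min J.card s) :
    ∑ τ ∈ (F.powerset ×ˢ F.powerset).filter (fun τ : Finset α × Finset α =>
        τ.2 ⊆ J₀ τ.1 ∧ min τ.1.card s ≤ u ∧ τ.2.card ≤ q),
        m.choose (u - min τ.1.card s) * (u - min τ.1.card s).choose (q - τ.2.card) =
      u.choose q * ∑ j ∈ range (F.card + 1), F.card.choose j *
        (if min j s ≤ u then m.choose (u - min j s) else 0) := by
  rw [sum_filter, sum_product]
  have hinner : ∀ J ∈ F.powerset,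
      (∑ Q ∈ F.powerset, if Q ⊆ J₀ J ∧ min J.card s ≤ u ∧ Q.card ≤ q then
          m.choose (u - min J.card s) * (u - min J.card s).choose (q - Q.card) else 0) =
        u.choose q * (if min J.card s ≤ u then m.choose (u - min J.card s) else 0) := by
    intro J hJ
    rw [mem_powerset] at hJ
    have hK := hJ₀ J
    have hKF : J₀ J ⊆ F := hK.1.trans hJ
    have h1 : (∑ Q ∈ F.powerset, if Q ⊆ J₀ J ∧ min J.card s ≤ u ∧ Q.card ≤ q then
          m.choose (u - min J.card s) * (u - min J.card s).choose (q - Q.card) else 0) =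
        ∑ Q ∈ (J₀ J).powerset, if min J.card s ≤ u ∧ Q.card ≤ q then
          m.choose (u - min J.card s) * (u - min J.card s).choose (q - Q.card) else 0 := by
      rw [← sum_subset (powerset_mono.2 hKF)]
      · apply sum_congr rfl
        intro Q hQ
        rw [mem_powerset] at hQ
        simp only [hQ, true_and]
      · intro Q _ hQn
        rw [mem_powerset] at hQn
        simp only [hQn, false_and, if_false]
    rw [h1]
    by_cases hc : min J.card s ≤ u
    · rw [if_pos hc]
      have h2 : (∑ Q ∈ (J₀ J).powerset, if min J.card s ≤ u ∧ Q.card ≤ q then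
            m.choose (u - min J.card s) * (u - min J.card s).choose (q - Q.card) else 0) =
          ∑ Q ∈ (J₀ J).powerset, (fun x => m.choose (u - min J.card s) *
            (if x ≤ q then (u - min J.card s).choose (q - x) else 0)) Q.card := by
        apply sum_congr rfl
        intro Q _
        simp only [hc, true_and]
        split_ifs <;> simp
      rw [h2, sum_powerset_apply_card (fun x => m.choose (u - min J.card s) *
            (if x ≤ q then (u - min J.card s).choose (q - x) else 0)), hK.2]
      simp only [smul_eq_mul]
      have h3 : (∑ x ∈ range (min J.card s + 1), (min J.card s).choose x *
          (m.choose (u - min J.card s) * (if x ≤ q then (u - min J.card s).choose (q - x) else 0))) =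
          m.choose (u - min J.card s) * ∑ x ∈ range (min J.card s + 1), (min J.card s).choose x *
            (if x ≤ q then (u - min J.card s).choose (q - x) else 0) := by
        rw [mul_sum]
        apply sum_congr rfl
        intro x _
        ring
      rw [h3, sum_choose_mul_choose_eq_choose _ q u hc]
      ring
    · rw [if_neg hc, mul_zero]
      apply sum_eq_zero
      intro Q _
      rw [if_neg]
      intro h
      exact hc h.1
  rw [sum_congr rfl hinner]
  rw [sum_powerset_apply_card (fun j => u.choose q * (if min j s ≤ u then m.choose (u - min j s) else 0))]
  simp only [smul_eq_mul]
  rw [mul_sum]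
  apply sum_congr rfl
  intro j _
  ring


end OneFlat

end PercRepro
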